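import Literature.Analysis.FluidPDE.OseenKernelComplex
import Literature.Analysis.FluidPDE.KochTataruKernel
import HarnessLib

/-!
# Bounds for the complexified kernels on the parabolic sector

Analysis/FluidPDE support file (everything proved, no definitions), second layer (W2) of the
proof of `Literature.Analysis.FluidPDE.lemarieRieusset2016_local_analyticity`
(`NSBoundedMildAnalytic.lean`; Lemarié-Rieusset 2016, Thm. 9.12, proof pp. 261–263: the bounds
`|W_{ν(τ-t₀)}(z-y)| ≤ …`, `|∂ₗO_{j,k}(Z)| ≤ C_γ`, `|Z|⁴|∂ₗO_{j,k}(Z)| ≤ C_γ` of the holomorphically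
extended kernels on the cone `Ω_γ`). In the root-time variables of `OseenKernelComplex.lean`
(`m² = t`) the parabolic sector is `{0 < Re m, |Im m| ≤ Re m/2}` and the admissible complex
displacements are `ζ = z - c` with `z ∈ ℝ^ι` real and `‖c‖ ≤ ‖m‖` (a complex shift of at most one
parabolic unit — in the Galilean scheme `c = m² g` with `‖g‖ ≤ ‖m‖⁻¹`). On this set:

* geometry of the sector (`norm_sq_le_of_sector`, `re_inv_four_mul_sq_ge`, …) and of the
  quadratic form: `Re (ζ·ζ/4m²) ≥ (3/50)‖z‖²/ρ² - 2`, `ρ = Re m` (`re_quadForm_ge`), and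
  `‖ζ‖ ≤ ‖z‖ + (3/2)ρ`;
* **the three scalar kernels are dominated by the real kernels at the dilated time
  `τ' = (25/6)ρ²`**: `|heatKernelC m ζ| ≤ e² λ^{d/2} G_{τ'}(z)`,
  `|oseenWeightAC m ζ| ≤ e² λ^{d/2+1} A(τ', z)`, `|oseenWeightBC m ζ| ≤ e² λ^{d/2+2} B(τ', z)`,
  `λ = 25/6` (through `|Ψ_q(w)| ≤ Ψ_q(Re w)`, monotonicity and the shift rule
  `Ψ_q(r - 2) ≤ e² Ψ_q(r)` of the real weight integrals, and the factorisations of `A`, `B`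
  through `Ψ`, `integral_Ioi_heatKernel_div_pow`);
* hence **Koch–Tataru's bound (14) for the complexified kernel** with the same parabolic
  majorant, `‖oseenKernelC m ζ a b‖ ≤ C (τ' + ‖z‖²)^{-(d+1)/2} ‖a‖‖b‖`
  (`exists_norm_oseenKernelC_shift_le`, the proof of `exists_norm_oseenKernel_le` verbatim on the
  dominating real kernels), and the **`L¹` bounds** consumed by the complexified Oseen scheme:
  `∫ ‖oseenKernelC m (cx(x-y) - c)[A y, B y]‖ dy ≤ C ρ⁻¹ sup‖A‖ sup‖B‖`,
  `∫ |heatKernelC m (cx(x-y) - c)| ‖F y‖ dy ≤ e² λ^{d/2} sup‖F‖`;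
* continuity of the kernels away from `m = 0`.

## Mathlib / tree search

Tree: `exists_heatKernel_le_rpow`, `exists_oseenWeightA_le`, `exists_oseenWeightB_le`,
`norm_le_add_sq_rpow_half`, `lintegral_add_norm_sq_rpow_neg`, `integrable_add_norm_sq_rpow_neg`,
`integral_one_add_norm_sq_rpow_neg_pos` (`KochTataruKernel.lean`);
`UnboundedOperators.integral_heatKernel_eq_one_holds`, `heatKernel_pos` (`HeatKernel.lean`);
`integral_Ioi_heatKernel_div_pow`, `norm_cdot_le`, `norm_psiWeight_integrand` (W1).
Mathlib: `Complex.inv_re`, `Complex.normSq_apply`, `Complex.norm_exp`, `Complex.re_le_norm`,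
`lintegral_sub_left_eq_self`, `integrableOn_Ioi_rpow_of_lt`, `setIntegral_mono_on`.
-/

noncomputable section

open MeasureTheory Set Filter Metric Real
open _root_.Topology
open scoped BigOperators ENNReal

namespace Literature.Analysis.FluidPDE

open Literature.Analysis.FunctionSpaces.EuclideanSpace (complexify complexify_apply norm_complexify)
open UnboundedOperators (heatKernel)

variable {ι : Type*} [Fintype ι]

/-! ### Geometry of the root-time sector `0 < Re m`, `|Im m| ≤ Re m / 2` -/

section Sector

variable {m : ℂ}

/-- `‖m‖² ≤ (5/4) (Re m)²` on the sector. [folklore] -/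
theorem norm_sq_le_of_sector (hsec : |m.im| ≤ m.re / 2) : ‖m‖ ^ 2 ≤ 5 / 4 * m.re ^ 2 := by
  rw [Complex.sq_norm, Complex.normSq_apply]
  have h := abs_le.1 hsec
  nlinarith [h.1, h.2]

/-- `‖m‖ ≤ (3/2) Re m` on the sector. [folklore] -/
theorem norm_le_of_sector (hm : 0 < m.re) (hsec : |m.im| ≤ m.re / 2) : ‖m‖ ≤ 3 / 2 * m.re := by
  have h := norm_sq_le_of_sector hsec
  have h2 : ‖m‖ ^ 2 ≤ (3 / 2 * m.re) ^ 2 := by nlinarith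
  exact (pow_le_pow_iff_left₀ (norm_nonneg _) (by positivity) two_ne_zero).1 h2

/-- `Re m ≤ ‖m‖`, so `‖m‖ > 0` on the sector. [folklore] -/
theorem norm_pos_of_sector (hm : 0 < m.re) : 0 < ‖m‖ := hm.trans_le (Complex.re_le_norm m)

/-- `m ≠ 0` on the sector. [folklore] -/
theorem ne_zero_of_sector (hm : 0 < m.re) : m ≠ 0 :=
  norm_pos_iff.1 (norm_pos_of_sector hm)

/-- `Re (m²) ≥ (3/4)(Re m)²` on the sector. [folklore] -/
theorem re_sq_ge_of_sector (hsec : |m.im| ≤ m.re / 2) : 3 / 4 * m.re ^ 2 ≤ (m ^ 2).re := by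
  have e : (m ^ 2).re = m.re ^ 2 - m.im ^ 2 := by rw [pow_two, Complex.mul_re]; ring
  rw [e]
  have h := abs_le.1 hsec
  nlinarith [h.1, h.2]

/-- `‖(k mⁿ)⁻¹‖ ≤ (k (Re m)ⁿ)⁻¹` for `k > 0` on the sector (`‖m‖ ≥ Re m > 0`). [folklore] -/
theorem norm_inv_const_mul_pow_le (hm : 0 < m.re) {k : ℝ} (hk : 0 < k) (n : ℕ) :
    ‖((k : ℂ) * m ^ n)⁻¹‖ ≤ (k * m.re ^ n)⁻¹ := by
  rw [norm_inv, norm_mul, Complex.norm_real, Real.norm_of_nonneg hk.le, norm_pow]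
  refine inv_anti₀ (by positivity) ?_
  gcongr
  exact Complex.re_le_norm m

/-- `‖(mⁿ)⁻¹‖ ≤ ((Re m)ⁿ)⁻¹` on the sector. [folklore] -/
theorem norm_inv_pow_le (hm : 0 < m.re) (n : ℕ) : ‖(m ^ n)⁻¹‖ ≤ (m.re ^ n)⁻¹ := by
  have h := norm_inv_const_mul_pow_le hm one_pos n
  simpa using h

/-- **The real part of `(4m²)⁻¹` is bounded below on the sector**: `Re (4m²)⁻¹ ≥ 3/(25 (Re m)²)`
(`Re w⁻¹ = Re w/‖w‖²`, `Re(m²) ≥ (3/4)ρ²`, `‖m‖⁴ ≤ (25/16)ρ⁴`). [folklore] -/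
theorem re_inv_four_mul_sq_ge (hm : 0 < m.re) (hsec : |m.im| ≤ m.re / 2) :
    3 / (25 * m.re ^ 2) ≤ ((4 : ℂ) * m ^ 2)⁻¹.re := by
  have hm0 : m ≠ 0 := ne_zero_of_sector hm
  have h1 : ((4 : ℂ) * m ^ 2).re = 4 * (m ^ 2).re := by simp [Complex.mul_re]
  have h2 : Complex.normSq ((4 : ℂ) * m ^ 2) = 16 * ‖m‖ ^ 4 := by
    rw [← Complex.sq_norm, norm_mul, norm_pow, Complex.norm_ofNat]; ring
  rw [Complex.inv_re, h1, h2]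
  have h3 := re_sq_ge_of_sector hsec
  have h4 := norm_sq_le_of_sector hsec
  have h5 : ‖m‖ ^ 4 ≤ 25 / 16 * m.re ^ 4 := by nlinarith [norm_nonneg m, sq_nonneg ‖m‖]
  have h6 : 0 < ‖m‖ ^ 4 := by have := norm_pos_of_sector hm; positivity
  rw [div_le_div_iff₀ (by positivity) (by positivity)]
  nlinarith [h3, h5, sq_nonneg m.re]

end Sector

/-! ### The quadratic form `ζ·ζ (4m²)⁻¹` on the admissible set -/

section QuadForm

variable {m : ℂ}

/-- The complex displacement `ζ = cx z - c` has `ζ·ζ = ‖z‖² + E` with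
`‖E‖ ≤ 2‖z‖‖c‖ + ‖c‖²` (bilinearity and Cauchy–Schwarz). [folklore] -/
theorem norm_cdot_shift_sub_le (z : (EuclideanSpace ℝ ι)) (c : (EuclideanSpace ℂ ι)) :
    ‖cdot (complexify z - c) (complexify z - c) - ((‖z‖ ^ 2 : ℝ) : ℂ)‖ ≤
      2 * ‖z‖ * ‖c‖ + ‖c‖ ^ 2 := by
  have e : cdot (complexify z - c) (complexify z - c) - ((‖z‖ ^ 2 : ℝ) : ℂ) =
      -(2 * cdot (complexify z) c) + cdot c c := by
    rw [cdot_sub_left, cdot_comm (complexify z) (complexify z - c), cdot_comm c (complexify z - c),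
      cdot_sub_left, cdot_sub_left, cdot_complexify_self, cdot_comm c (complexify z)]
    ring
  rw [e]
  calc ‖-(2 * cdot (complexify z) c) + cdot c c‖
      ≤ ‖-(2 * cdot (complexify z) c)‖ + ‖cdot c c‖ := norm_add_le _ _
    _ = 2 * ‖cdot (complexify z) c‖ + ‖cdot c c‖ := by
        rw [norm_neg, norm_mul, Complex.norm_ofNat]
    _ ≤ 2 * (‖complexify z‖ * ‖c‖) + ‖c‖ * ‖c‖ :=
        add_le_add (mul_le_mul_of_nonneg_left (norm_cdot_le _ _) (by norm_num)) (norm_cdot_le _ _)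
    _ = 2 * ‖z‖ * ‖c‖ + ‖c‖ ^ 2 := by rw [norm_complexify]; ring

/-- **The displacement is at most `‖z‖ + (3/2)ρ` in norm** on the admissible set. [folklore] -/
theorem norm_shift_le (hm : 0 < m.re) (hsec : |m.im| ≤ m.re / 2) {c : (EuclideanSpace ℂ ι)} (hc : ‖c‖ ≤ ‖m‖)
    (z : (EuclideanSpace ℝ ι)) :
    ‖complexify z - c‖ ≤ ‖z‖ + 3 / 2 * m.re :=
  calc ‖complexify z - c‖ ≤ ‖complexify z‖ + ‖c‖ := norm_sub_le _ _
    _ ≤ ‖z‖ + 3 / 2 * m.re := by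
        rw [norm_complexify]
        exact add_le_add le_rfl (hc.trans (norm_le_of_sector hm hsec))

/-- **Lower bound for the real part of the quadratic form** on the admissible set:
`Re (ζ·ζ (4m²)⁻¹) ≥ (3/50) ‖z‖²/ρ² - 2`, `ρ = Re m` — the Gaussian `exp(-ζ·ζ/4m²)` keeps a
definite fraction of its real decay (Lemarié-Rieusset 2016, proof of Thm. 9.12, p. 262:
"`Re(Z²) ≥ -γ² + (1/(1+γ²)) (Re z)²/(ν Re τ)`"). [cite: LemarieRieusset2016, Thm. 9.12 (proof, p. 262)] -/
theorem re_quadForm_ge (hm : 0 < m.re) (hsec : |m.im| ≤ m.re / 2) {c : (EuclideanSpace ℂ ι)} (hc : ‖c‖ ≤ ‖m‖)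
    (z : (EuclideanSpace ℝ ι)) :
    3 * ‖z‖ ^ 2 / (50 * m.re ^ 2) - 2 ≤
      (cdot (complexify z - c) (complexify z - c) * ((4 : ℂ) * m ^ 2)⁻¹).re := by
  set ρ : ℝ := m.re with hρ
  set μ : ℂ := ((4 : ℂ) * m ^ 2)⁻¹ with hμ
  set Q : ℂ := cdot (complexify z - c) (complexify z - c) with hQ
  set E : ℂ := Q - ((‖z‖ ^ 2 : ℝ) : ℂ) with hE
  have hnm : 0 < ‖m‖ := norm_pos_of_sector hm
  have hρm : ρ ≤ ‖m‖ := Complex.re_le_norm m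
  -- the pieces
  have hEn : ‖E‖ ≤ 2 * ‖z‖ * ‖m‖ + ‖m‖ ^ 2 :=
    (norm_cdot_shift_sub_le z c).trans (by nlinarith [norm_nonneg c, norm_nonneg z, hc])
  have hμn : ‖μ‖ ≤ (4 * ‖m‖ ^ 2)⁻¹ := by
    rw [hμ, norm_inv, norm_mul, Complex.norm_ofNat, norm_pow]
  have hμre : 3 / (25 * ρ ^ 2) ≤ μ.re := re_inv_four_mul_sq_ge hm hsec
  -- `Re (Q μ) = ‖z‖² Re μ + Re (E μ)`
  have hsplit : (Q * μ).re = ‖z‖ ^ 2 * μ.re + (E * μ).re := by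
    have : Q = ((‖z‖ ^ 2 : ℝ) : ℂ) + E := by rw [hE]; ring
    rw [this, add_mul, Complex.add_re, Complex.re_ofReal_mul]
  have hEμ : -(‖E‖ * ‖μ‖) ≤ (E * μ).re := by
    have h := Complex.abs_re_le_norm (E * μ)
    rw [norm_mul] at h
    exact (abs_le.1 h).1
  -- `‖E‖ ‖μ‖ ≤ ‖z‖/(2ρ) + 1/4`
  have hEμ' : ‖E‖ * ‖μ‖ ≤ ‖z‖ / (2 * ρ) + 1 / 4 := by
    calc ‖E‖ * ‖μ‖ ≤ (2 * ‖z‖ * ‖m‖ + ‖m‖ ^ 2) * (4 * ‖m‖ ^ 2)⁻¹ :=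
          mul_le_mul hEn hμn (norm_nonneg _) (by positivity)
      _ = ‖z‖ / (2 * ‖m‖) + 1 / 4 := by field_simp; ring
      _ ≤ ‖z‖ / (2 * ρ) + 1 / 4 := by gcongr
  -- `‖z‖² Re μ ≥ (3/25) ‖z‖²/ρ²`
  have hmain : 3 / (25 * ρ ^ 2) * ‖z‖ ^ 2 ≤ ‖z‖ ^ 2 * μ.re := by
    rw [mul_comm]; exact mul_le_mul_of_nonneg_left hμre (sq_nonneg _)
  -- the elementary inequality `X/2 ≤ (3/50) X² + 7/4`, `X = ‖z‖/ρ`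
  set X : ℝ := ‖z‖ / ρ with hX
  have hX0 : 0 ≤ X := by positivity
  have hzX : ‖z‖ = X * ρ := by rw [hX]; field_simp
  have helem : X / 2 ≤ 3 / 50 * X ^ 2 + 7 / 4 := by nlinarith [sq_nonneg (X - 25 / 6)]
  rw [hsplit]
  have e1 : 3 * ‖z‖ ^ 2 / (50 * ρ ^ 2) = 3 / 50 * X ^ 2 := by rw [hzX]; field_simp
  have e2 : 3 / (25 * ρ ^ 2) * ‖z‖ ^ 2 = 3 / 25 * X ^ 2 := by rw [hzX]; field_simp
  have e3 : ‖z‖ / (2 * ρ) = X / 2 := by rw [hzX]; field_simp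
  rw [e1]
  rw [e2] at hmain
  rw [e3] at hEμ'
  linarith

/-- **The complex Gaussian factor keeps Gaussian decay**:
`‖exp(-ζ·ζ (4m²)⁻¹)‖ ≤ e² exp(-(3/50)‖z‖²/ρ²)` on the admissible set. [folklore] -/
theorem norm_exp_neg_quadForm_le (hm : 0 < m.re) (hsec : |m.im| ≤ m.re / 2) {c : (EuclideanSpace ℂ ι)}
    (hc : ‖c‖ ≤ ‖m‖) (z : (EuclideanSpace ℝ ι)) :
    ‖Complex.exp (-(cdot (complexify z - c) (complexify z - c) * ((4 : ℂ) * m ^ 2)⁻¹))‖ ≤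
      Real.exp 2 * Real.exp (-(3 * ‖z‖ ^ 2 / (50 * m.re ^ 2))) := by
  rw [Complex.norm_exp, Complex.neg_re, ← Real.exp_add]
  exact Real.exp_le_exp.2 (by linarith [re_quadForm_ge hm hsec hc z])

end QuadForm

/-! ### The dilated real time `τ' = (25/6) ρ²` and the Gaussian -/

section Gaussian

variable {m : ℂ}

/-- `(4π)^{-d/2} ρ^{-d} = λ^{d/2} (4π λρ²)^{-d/2}` for `ρ, λ > 0` (`d = |ι|`). [folklore] -/
theorem heatConst_mul_inv_pow_eq {ρ lam : ℝ} (hρ : 0 < ρ) (hlam : 0 < lam) :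
    heatConst ι * (ρ ^ Fintype.card ι)⁻¹ =
      lam ^ ((Fintype.card ι : ℝ) / 2) *
        (4 * π * (lam * ρ ^ 2)) ^ (-(Module.finrank ℝ (EuclideanSpace ℝ ι) : ℝ) / 2) := by
  rw [finrank_euclideanSpace, heatConst]
  set d : ℝ := (Fintype.card ι : ℝ) with hd
  have e0 : (4 * π * (lam * ρ ^ 2)) ^ (-d / 2) =
      (4 * π) ^ (-d / 2) * (lam ^ (-d / 2) * (ρ ^ 2) ^ (-d / 2)) := by
    rw [Real.mul_rpow (by positivity : (0 : ℝ) ≤ 4 * π) (by positivity : (0 : ℝ) ≤ lam * ρ ^ 2),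
      Real.mul_rpow hlam.le (by positivity)]
  have e1 : (ρ ^ 2) ^ (-d / 2) = (ρ ^ Fintype.card ι)⁻¹ := by
    rw [← Real.rpow_natCast ρ 2, ← Real.rpow_mul hρ.le, ← Real.rpow_natCast ρ (Fintype.card ι),
      ← Real.rpow_neg hρ.le]
    congr 1; simp only [hd]; push_cast; ring
  have e2 : lam ^ (d / 2) * lam ^ (-d / 2) = 1 := by
    rw [← Real.rpow_add hlam]; ring_nf; exact Real.rpow_zero lam
  rw [e0, e1]
  calc (4 * π) ^ (-d / 2) * (ρ ^ Fintype.card ι)⁻¹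
      = (lam ^ (d / 2) * lam ^ (-d / 2)) * ((4 * π) ^ (-d / 2) * (ρ ^ Fintype.card ι)⁻¹) := by
        rw [e2, one_mul]
    _ = _ := by ring

/-- **The complexified Gaussian is dominated by the real Gaussian at the dilated time**
`τ' = (25/6) ρ²`: `‖heatKernelC m (cx z - c)‖ ≤ e² (25/6)^{d/2} G_{τ'}(z)` on the admissible set
(Lemarié-Rieusset 2016, proof of Thm. 9.12, p. 262, first display). [cite: LemarieRieusset2016, Thm. 9.12 (proof, p. 262)] -/
theorem norm_heatKernelC_shift_le (hm : 0 < m.re) (hsec : |m.im| ≤ m.re / 2) {c : (EuclideanSpace ℂ ι)}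
    (hc : ‖c‖ ≤ ‖m‖) (z : (EuclideanSpace ℝ ι)) :
    ‖heatKernelC m (complexify z - c)‖ ≤
      Real.exp 2 * (25 / 6 : ℝ) ^ ((Fintype.card ι : ℝ) / 2) * heatKernel (25 / 6 * m.re ^ 2) z := by
  set ρ : ℝ := m.re with hρ
  have hlam : (0 : ℝ) < 25 / 6 := by norm_num
  unfold heatKernelC UnboundedOperators.heatKernel
  rw [norm_mul, norm_mul, Complex.norm_real, Real.norm_of_nonneg heatConst_pos.le]
  have h1 : ‖(m ^ Fintype.card ι)⁻¹‖ ≤ (ρ ^ Fintype.card ι)⁻¹ := norm_inv_pow_le hm _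
  have h2 := norm_exp_neg_quadForm_le hm hsec hc z
  have hexp : Real.exp (-(3 * ‖z‖ ^ 2 / (50 * ρ ^ 2))) =
      Real.exp (-‖z‖ ^ 2 / (4 * (25 / 6 * ρ ^ 2))) := by
    congr 1; field_simp; ring
  calc _ ≤ heatConst ι * (ρ ^ Fintype.card ι)⁻¹ *
          (Real.exp 2 * Real.exp (-(3 * ‖z‖ ^ 2 / (50 * ρ ^ 2)))) := by
        gcongr <;> first
          | exact heatConst_pos.le
          | exact mul_nonneg heatConst_pos.le (by positivity)
    _ = Real.exp 2 * (25 / 6 : ℝ) ^ ((Fintype.card ι : ℝ) / 2) *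
          ((4 * π * (25 / 6 * ρ ^ 2)) ^ (-(Module.finrank ℝ (EuclideanSpace ℝ ι) : ℝ) / 2) *
            Real.exp (-‖z‖ ^ 2 / (4 * (25 / 6 * ρ ^ 2)))) := by
        rw [heatConst_mul_inv_pow_eq hm hlam, hexp]; ring

end Gaussian

/-! ### The real weight integrals `Ψ_q(r)`: monotonicity, shifts, factorisation -/

section PsiReal

/-- The real weight integrand `σ^{-q} e^{-r/σ}` is integrable on `(1, ∞)` for `q > 1`
(bounded by `σ^{-q} e^{|r|}`). [folklore] -/
theorem integrableOn_psi_real {q : ℝ} (hq : 1 < q) (r : ℝ) :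
    IntegrableOn (fun σ : ℝ => σ ^ (-q) * Real.exp (-(r / σ))) (Ioi 1) := by
  have hmaj : IntegrableOn (fun σ : ℝ => σ ^ (-q) * Real.exp |r|) (Ioi 1) :=
    (integrableOn_Ioi_rpow_of_lt (by linarith) one_pos).mul_const _
  refine hmaj.mono' ?_ ?_
  · refine ContinuousOn.aestronglyMeasurable (fun σ hσ => ?_) measurableSet_Ioi
    have hσ0 : (σ : ℝ) ≠ 0 := (one_pos.trans hσ).ne'
    exact ((continuousAt_id.rpow_const (Or.inl hσ0)).mul
      ((continuousAt_const.div continuousAt_id hσ0).neg.rexp)).continuousWithinAt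
  · rw [ae_restrict_iff' measurableSet_Ioi]
    refine Eventually.of_forall fun σ hσ => ?_
    have hσ0 : 0 < σ := one_pos.trans hσ
    rw [Real.norm_of_nonneg (by positivity)]
    refine mul_le_mul_of_nonneg_left (Real.exp_le_exp.2 ?_) (Real.rpow_nonneg hσ0.le _)
    calc -(r / σ) ≤ |r / σ| := neg_le_abs _
      _ = |r| / σ := by rw [abs_div, abs_of_pos hσ0]
      _ ≤ |r| := div_le_self (abs_nonneg _) hσ.le

/-- **`|Ψ_q(w)| ≤ Ψ_q(Re w)`** (the modulus of the integrand depends on `Re w` only). [folklore] -/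
theorem norm_psiWeight_le_real {q : ℝ} (hq : 1 < q) (w : ℂ) :
    ‖psiWeight q w‖ ≤ ∫ σ in Ioi (1 : ℝ), σ ^ (-q) * Real.exp (-(w.re / σ)) := by
  unfold psiWeight
  refine norm_integral_le_of_norm_le (integrableOn_psi_real hq w.re) ?_
  rw [ae_restrict_iff' measurableSet_Ioi]
  exact Eventually.of_forall fun σ hσ => (norm_psiWeight_integrand (one_pos.trans hσ) q w).le

/-- **Monotonicity**: `Ψ_q(r') ≤ Ψ_q(r)` for `r ≤ r'`. [folklore] -/
theorem psi_real_antitone {q : ℝ} (hq : 1 < q) {r r' : ℝ} (h : r ≤ r') :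
    ∫ σ in Ioi (1 : ℝ), σ ^ (-q) * Real.exp (-(r' / σ)) ≤
      ∫ σ in Ioi (1 : ℝ), σ ^ (-q) * Real.exp (-(r / σ)) := by
  refine setIntegral_mono_on (integrableOn_psi_real hq r') (integrableOn_psi_real hq r)
    measurableSet_Ioi fun σ hσ => ?_
  have hσ0 : 0 < σ := one_pos.trans hσ
  refine mul_le_mul_of_nonneg_left (Real.exp_le_exp.2 ?_) (Real.rpow_nonneg hσ0.le _)
  exact neg_le_neg (div_le_div_of_nonneg_right h hσ0.le)

/-- **Shift rule**: `Ψ_q(r - c₂) ≤ e^{c₂} Ψ_q(r)` for `c₂ ≥ 0` (`e^{c₂/σ} ≤ e^{c₂}` on `σ > 1`).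
[folklore] -/
theorem psi_real_sub_le {q : ℝ} (hq : 1 < q) (r : ℝ) {c₂ : ℝ} (hc₂ : 0 ≤ c₂) :
    ∫ σ in Ioi (1 : ℝ), σ ^ (-q) * Real.exp (-((r - c₂) / σ)) ≤
      Real.exp c₂ * ∫ σ in Ioi (1 : ℝ), σ ^ (-q) * Real.exp (-(r / σ)) := by
  rw [← integral_const_mul]
  refine setIntegral_mono_on (integrableOn_psi_real hq _) ((integrableOn_psi_real hq r).const_mul _)
    measurableSet_Ioi fun σ hσ => ?_
  have hσ0 : 0 < σ := one_pos.trans hσ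
  have h1 : -((r - c₂) / σ) = c₂ / σ + -(r / σ) := by field_simp; ring
  rw [h1, Real.exp_add, ← mul_assoc, mul_comm (σ ^ (-q)), mul_assoc]
  refine mul_le_mul_of_nonneg_right (Real.exp_le_exp.2 (div_le_self hc₂ hσ.le)) ?_
  exact mul_nonneg (Real.rpow_nonneg hσ0.le _) (Real.exp_pos _).le

/-- **Factorisation of the first weight**: `Ψ_{d/2+2}(‖z‖²/4τ) = (4πτ)^{d/2} (4τ) A(τ, z)` for
`τ > 0`. [folklore] -/
theorem psi_real_eq_oseenWeightA {τ : ℝ} (hτ : 0 < τ) (z : (EuclideanSpace ℝ ι)) :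
    ∫ σ in Ioi (1 : ℝ), σ ^ (-((Fintype.card ι : ℝ) / 2 + 2)) * Real.exp (-(‖z‖ ^ 2 / (4 * τ) / σ)) =
      (4 * π * τ) ^ ((Module.finrank ℝ (EuclideanSpace ℝ ι) : ℝ) / 2) * (4 * τ) * oseenWeightA τ z := by
  have h := integral_Ioi_heatKernel_div_pow hτ z (by norm_num : (4 : ℝ) ≠ 0) 2
  unfold oseenWeightA
  rw [h]
  have hpos : 0 < 4 * π * τ := by positivity
  have e : (4 * π * τ) ^ ((Module.finrank ℝ (EuclideanSpace ℝ ι) : ℝ) / 2) *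
      (4 * π * τ) ^ (-(Module.finrank ℝ (EuclideanSpace ℝ ι) : ℝ) / 2) = 1 := by
    rw [← Real.rpow_add hpos]; ring_nf; exact Real.rpow_zero _
  have hτ0 : τ ≠ 0 := hτ.ne'
  push_cast
  calc _ = ((4 * π * τ) ^ ((Module.finrank ℝ (EuclideanSpace ℝ ι) : ℝ) / 2) *
        (4 * π * τ) ^ (-(Module.finrank ℝ (EuclideanSpace ℝ ι) : ℝ) / 2)) *
        ∫ σ in Ioi (1 : ℝ), σ ^ (-((Fintype.card ι : ℝ) / 2 + 2)) *
          Real.exp (-(‖z‖ ^ 2 / (4 * τ) / σ)) := by rw [e, one_mul]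
    _ = _ := by field_simp

/-- **Factorisation of the second weight**: `Ψ_{d/2+3}(‖z‖²/4τ) = (4πτ)^{d/2} (8τ²) B(τ, z)` for
`τ > 0`. [folklore] -/
theorem psi_real_eq_oseenWeightB {τ : ℝ} (hτ : 0 < τ) (z : (EuclideanSpace ℝ ι)) :
    ∫ σ in Ioi (1 : ℝ), σ ^ (-((Fintype.card ι : ℝ) / 2 + 3)) * Real.exp (-(‖z‖ ^ 2 / (4 * τ) / σ)) =
      (4 * π * τ) ^ ((Module.finrank ℝ (EuclideanSpace ℝ ι) : ℝ) / 2) * (8 * τ ^ 2) * oseenWeightB τ z := by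
  have h := integral_Ioi_heatKernel_div_pow hτ z (by norm_num : (8 : ℝ) ≠ 0) 3
  unfold oseenWeightB
  rw [h]
  have hpos : 0 < 4 * π * τ := by positivity
  have e : (4 * π * τ) ^ ((Module.finrank ℝ (EuclideanSpace ℝ ι) : ℝ) / 2) *
      (4 * π * τ) ^ (-(Module.finrank ℝ (EuclideanSpace ℝ ι) : ℝ) / 2) = 1 := by
    rw [← Real.rpow_add hpos]; ring_nf; exact Real.rpow_zero _
  have hτ0 : τ ≠ 0 := hτ.ne'
  push_cast
  calc _ = ((4 * π * τ) ^ ((Module.finrank ℝ (EuclideanSpace ℝ ι) : ℝ) / 2) *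
        (4 * π * τ) ^ (-(Module.finrank ℝ (EuclideanSpace ℝ ι) : ℝ) / 2)) *
        ∫ σ in Ioi (1 : ℝ), σ ^ (-((Fintype.card ι : ℝ) / 2 + 3)) *
          Real.exp (-(‖z‖ ^ 2 / (4 * τ) / σ)) := by rw [e, one_mul]
    _ = _ := by field_simp

end PsiReal

/-! ### The complexified weights against the real weights at the dilated time -/

section Weights

variable {m : ℂ}

/-- The chain `|Ψ_q(w)| ≤ Ψ_q(Re w) ≤ Ψ_q((3/50)X² - 2) ≤ e² Ψ_q(‖z‖²/(4τ'))`, `τ' = (25/6)ρ²`,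
for the quadratic-form argument `w = ζ·ζ (4m²)⁻¹` on the admissible set. [folklore] -/
theorem norm_psiWeight_quadForm_le (hm : 0 < m.re) (hsec : |m.im| ≤ m.re / 2) {c : (EuclideanSpace ℂ ι)}
    (hc : ‖c‖ ≤ ‖m‖) {q : ℝ} (hq : 1 < q) (z : (EuclideanSpace ℝ ι)) :
    ‖psiWeight q (cdot (complexify z - c) (complexify z - c) * ((4 : ℂ) * m ^ 2)⁻¹)‖ ≤
      Real.exp 2 * ∫ σ in Ioi (1 : ℝ), σ ^ (-q) *
        Real.exp (-(‖z‖ ^ 2 / (4 * (25 / 6 * m.re ^ 2)) / σ)) := by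
  set w : ℂ := cdot (complexify z - c) (complexify z - c) * ((4 : ℂ) * m ^ 2)⁻¹ with hw
  have h1 := norm_psiWeight_le_real hq w
  have h2 : 3 * ‖z‖ ^ 2 / (50 * m.re ^ 2) - 2 ≤ w.re := re_quadForm_ge hm hsec hc z
  have h3 := psi_real_antitone hq h2
  have h4 := psi_real_sub_le hq (‖z‖ ^ 2 / (4 * (25 / 6 * m.re ^ 2))) (by norm_num : (0 : ℝ) ≤ 2)
  have e : 3 * ‖z‖ ^ 2 / (50 * m.re ^ 2) = ‖z‖ ^ 2 / (4 * (25 / 6 * m.re ^ 2)) := by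
    field_simp; ring
  rw [e] at h3
  exact h1.trans (h3.trans h4)

/-- **The first complexified weight against the real one**:
`‖oseenWeightAC m (cx z - c)‖ ≤ e² (25/6)^{d/2+1} A((25/6)ρ², z)` on the admissible set.
[folklore] -/
theorem norm_oseenWeightAC_shift_le (hm : 0 < m.re) (hsec : |m.im| ≤ m.re / 2) {c : (EuclideanSpace ℂ ι)}
    (hc : ‖c‖ ≤ ‖m‖) (z : (EuclideanSpace ℝ ι)) :
    ‖oseenWeightAC m (complexify z - c)‖ ≤
      Real.exp 2 * (25 / 6 : ℝ) ^ ((Fintype.card ι : ℝ) / 2 + 1) *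
        oseenWeightA (25 / 6 * m.re ^ 2) z := by
  set ρ : ℝ := m.re with hρ
  set τ' : ℝ := 25 / 6 * ρ ^ 2 with hτ'
  have hlam : (0 : ℝ) < 25 / 6 := by norm_num
  have hτ'0 : 0 < τ' := by positivity
  have hq : (1 : ℝ) < Fintype.card ι / 2 + 2 := by
    have : (0 : ℝ) ≤ Fintype.card ι := Nat.cast_nonneg _; linarith
  unfold oseenWeightAC
  rw [norm_mul, norm_mul, norm_mul, Complex.norm_real, Real.norm_of_nonneg heatConst_pos.le]
  have h1 : ‖(m ^ Fintype.card ι)⁻¹‖ ≤ (ρ ^ Fintype.card ι)⁻¹ := norm_inv_pow_le hm _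
  have h2 : ‖((4 : ℂ) * m ^ 2)⁻¹‖ ≤ (4 * ρ ^ 2)⁻¹ := by
    have := norm_inv_const_mul_pow_le hm (by norm_num : (0 : ℝ) < 4) 2
    push_cast at this; exact this
  have h3 := norm_psiWeight_quadForm_le hm hsec hc hq z
  rw [psi_real_eq_oseenWeightA hτ'0 z] at h3
  obtain ⟨-, hA0, -⟩ := (exists_oseenWeightA_le (E := (EuclideanSpace ℝ ι))).choose_spec.2 hτ'0 z
  have hkey := heatConst_mul_inv_pow_eq (ι := ι) hm hlam
  set d : ℝ := (Fintype.card ι : ℝ) with hd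
  have hfin : (Module.finrank ℝ (EuclideanSpace ℝ ι) : ℝ) = d := by rw [finrank_euclideanSpace]
  rw [hfin] at hkey h3
  have hpos : 0 < 4 * π * τ' := by positivity
  have e : (4 * π * τ') ^ (-d / 2) * (4 * π * τ') ^ (d / 2) = 1 := by
    rw [← Real.rpow_add hpos]; ring_nf; exact Real.rpow_zero _
  calc _ ≤ heatConst ι * (ρ ^ Fintype.card ι)⁻¹ * (4 * ρ ^ 2)⁻¹ *
          (Real.exp 2 * ((4 * π * τ') ^ (d / 2) * (4 * τ') * oseenWeightA τ' z)) := by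
        gcongr <;> first
          | exact heatConst_pos.le
          | exact mul_nonneg heatConst_pos.le (by positivity)
          | exact mul_nonneg (mul_nonneg heatConst_pos.le (by positivity)) (by positivity)
    _ = Real.exp 2 * ((25 / 6 : ℝ) ^ (d / 2) * (25 / 6)) *
          ((4 * π * τ') ^ (-d / 2) * (4 * π * τ') ^ (d / 2)) * oseenWeightA τ' z := by
        rw [hkey, hτ']; field_simp
    _ = Real.exp 2 * (25 / 6 : ℝ) ^ (d / 2 + 1) * oseenWeightA τ' z := by
        rw [e, Real.rpow_add hlam, Real.rpow_one]; ring

/-- **The second complexified weight against the real one**: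
`‖oseenWeightBC m (cx z - c)‖ ≤ e² (25/6)^{d/2+2} B((25/6)ρ², z)` on the admissible set.
[folklore] -/
theorem norm_oseenWeightBC_shift_le (hm : 0 < m.re) (hsec : |m.im| ≤ m.re / 2) {c : (EuclideanSpace ℂ ι)}
    (hc : ‖c‖ ≤ ‖m‖) (z : (EuclideanSpace ℝ ι)) :
    ‖oseenWeightBC m (complexify z - c)‖ ≤
      Real.exp 2 * (25 / 6 : ℝ) ^ ((Fintype.card ι : ℝ) / 2 + 2) *
        oseenWeightB (25 / 6 * m.re ^ 2) z := by
  set ρ : ℝ := m.re with hρ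
  set τ' : ℝ := 25 / 6 * ρ ^ 2 with hτ'
  have hlam : (0 : ℝ) < 25 / 6 := by norm_num
  have hτ'0 : 0 < τ' := by positivity
  have hq : (1 : ℝ) < Fintype.card ι / 2 + 3 := by
    have : (0 : ℝ) ≤ Fintype.card ι := Nat.cast_nonneg _; linarith
  unfold oseenWeightBC
  rw [norm_mul, norm_mul, norm_mul, Complex.norm_real, Real.norm_of_nonneg heatConst_pos.le]
  have h1 : ‖(m ^ Fintype.card ι)⁻¹‖ ≤ (ρ ^ Fintype.card ι)⁻¹ := norm_inv_pow_le hm _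
  have h2 : ‖((8 : ℂ) * m ^ 4)⁻¹‖ ≤ (8 * ρ ^ 4)⁻¹ := by
    have := norm_inv_const_mul_pow_le hm (by norm_num : (0 : ℝ) < 8) 4
    push_cast at this; exact this
  have h3 := norm_psiWeight_quadForm_le hm hsec hc hq z
  rw [psi_real_eq_oseenWeightB hτ'0 z] at h3
  obtain ⟨-, hB0, -⟩ := (exists_oseenWeightB_le (E := (EuclideanSpace ℝ ι))).choose_spec.2 hτ'0 z
  have hkey := heatConst_mul_inv_pow_eq (ι := ι) hm hlam
  set d : ℝ := (Fintype.card ι : ℝ) with hd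
  have hfin : (Module.finrank ℝ (EuclideanSpace ℝ ι) : ℝ) = d := by rw [finrank_euclideanSpace]
  rw [hfin] at hkey h3
  have hpos : 0 < 4 * π * τ' := by positivity
  have e : (4 * π * τ') ^ (-d / 2) * (4 * π * τ') ^ (d / 2) = 1 := by
    rw [← Real.rpow_add hpos]; ring_nf; exact Real.rpow_zero _
  calc _ ≤ heatConst ι * (ρ ^ Fintype.card ι)⁻¹ * (8 * ρ ^ 4)⁻¹ *
          (Real.exp 2 * ((4 * π * τ') ^ (d / 2) * (8 * τ' ^ 2) * oseenWeightB τ' z)) := by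
        gcongr <;> first
          | exact heatConst_pos.le
          | exact mul_nonneg heatConst_pos.le (by positivity)
          | exact mul_nonneg (mul_nonneg heatConst_pos.le (by positivity)) (by positivity)
    _ = Real.exp 2 * ((25 / 6 : ℝ) ^ (d / 2) * (25 / 6) ^ 2) *
          ((4 * π * τ') ^ (-d / 2) * (4 * π * τ') ^ (d / 2)) * oseenWeightB τ' z := by
        rw [hkey, hτ']; field_simp
    _ = Real.exp 2 * (25 / 6 : ℝ) ^ (d / 2 + 2) * oseenWeightB τ' z := by
        rw [e, Real.rpow_add hlam, show ((25 / 6 : ℝ)) ^ (2 : ℝ) = (25 / 6) ^ 2 from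
          Real.rpow_two _]; ring

end Weights

/-! ### Koch–Tataru's bound (14) for the complexified kernel -/

section KernelBound

variable {m : ℂ}

/-- `‖cx z - c‖ ≤ (5/2) (τ' + ‖z‖²)^{1/2}` on the admissible set, `τ' = (25/6) ρ²` (since
`ρ ≤ √τ'`, `‖z‖ ≤ √(τ' + ‖z‖²)`). [folklore] -/
theorem norm_shift_le_rpow_half (hm : 0 < m.re) (hsec : |m.im| ≤ m.re / 2) {c : (EuclideanSpace ℂ ι)}
    (hc : ‖c‖ ≤ ‖m‖) (z : (EuclideanSpace ℝ ι)) :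
    ‖complexify z - c‖ ≤ 5 / 2 * (25 / 6 * m.re ^ 2 + ‖z‖ ^ 2) ^ (1 / 2 : ℝ) := by
  set ρ : ℝ := m.re with hρ
  set s : ℝ := (25 / 6 * ρ ^ 2 + ‖z‖ ^ 2) ^ (1 / 2 : ℝ) with hs
  have hs0 : 0 ≤ s := Real.rpow_nonneg (by positivity) _
  have hs2 : s ^ 2 = 25 / 6 * ρ ^ 2 + ‖z‖ ^ 2 := by
    rw [hs, ← Real.rpow_natCast, ← Real.rpow_mul (by positivity)]; norm_num
  have hz : ‖z‖ ≤ s := norm_le_add_sq_rpow_half (by positivity) z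
  have hρs : ρ ≤ s := by nlinarith [hz, norm_nonneg z, hm]
  calc ‖complexify z - c‖ ≤ ‖z‖ + 3 / 2 * ρ := norm_shift_le hm hsec hc z
    _ ≤ s + 3 / 2 * s := by gcongr
    _ = 5 / 2 * s := by ring

/-- **Pointwise bound of the complexified Oseen kernel** (the analogue of `norm_oseenKernel_le`):
`‖oseenKernelC m ζ a b‖ ≤ (‖ζ‖ ‖(2m²)⁻¹‖ ‖𝒢‖ + 3 ‖𝒜‖ ‖ζ‖ + ‖ℬ‖ ‖ζ‖³) ‖a‖ ‖b‖`. [folklore] -/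
theorem norm_oseenKernelC_le (m : ℂ) (ζ a b : (EuclideanSpace ℂ ι)) :
    ‖oseenKernelC m ζ a b‖ ≤
      (‖ζ‖ * ‖((2 : ℂ) * m ^ 2)⁻¹‖ * ‖heatKernelC m ζ‖ + 3 * ‖oseenWeightAC m ζ‖ * ‖ζ‖ +
        ‖oseenWeightBC m ζ‖ * ‖ζ‖ ^ 3) * ‖a‖ * ‖b‖ := by
  unfold oseenKernelC
  have hza := norm_cdot_le ζ a
  have hzb := norm_cdot_le ζ b
  have hab := norm_cdot_le a b
  have h1 : ‖(-(cdot ζ a * ((2 : ℂ) * m ^ 2)⁻¹ * heatKernelC m ζ)) • b‖ ≤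
      ‖ζ‖ * ‖((2 : ℂ) * m ^ 2)⁻¹‖ * ‖heatKernelC m ζ‖ * ‖a‖ * ‖b‖ := by
    rw [norm_smul, norm_neg, norm_mul, norm_mul]
    calc ‖cdot ζ a‖ * ‖((2 : ℂ) * m ^ 2)⁻¹‖ * ‖heatKernelC m ζ‖ * ‖b‖
        ≤ (‖ζ‖ * ‖a‖) * ‖((2 : ℂ) * m ^ 2)⁻¹‖ * ‖heatKernelC m ζ‖ * ‖b‖ := by gcongr
      _ = _ := by ring
  have h2 : ‖oseenWeightAC m ζ • (cdot ζ a • b + cdot a b • ζ + cdot ζ b • a)‖ ≤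
      3 * ‖oseenWeightAC m ζ‖ * ‖ζ‖ * ‖a‖ * ‖b‖ := by
    rw [norm_smul]
    have : ‖cdot ζ a • b + cdot a b • ζ + cdot ζ b • a‖ ≤ 3 * (‖ζ‖ * ‖a‖ * ‖b‖) := by
      calc ‖cdot ζ a • b + cdot a b • ζ + cdot ζ b • a‖
          ≤ ‖cdot ζ a • b‖ + ‖cdot a b • ζ‖ + ‖cdot ζ b • a‖ := norm_add₃_le
        _ = ‖cdot ζ a‖ * ‖b‖ + ‖cdot a b‖ * ‖ζ‖ + ‖cdot ζ b‖ * ‖a‖ := by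
            rw [norm_smul, norm_smul, norm_smul]
        _ ≤ ‖ζ‖ * ‖a‖ * ‖b‖ + ‖a‖ * ‖b‖ * ‖ζ‖ + ‖ζ‖ * ‖b‖ * ‖a‖ := by gcongr
        _ = 3 * (‖ζ‖ * ‖a‖ * ‖b‖) := by ring
    calc ‖oseenWeightAC m ζ‖ * ‖cdot ζ a • b + cdot a b • ζ + cdot ζ b • a‖
        ≤ ‖oseenWeightAC m ζ‖ * (3 * (‖ζ‖ * ‖a‖ * ‖b‖)) := by gcongr
      _ = _ := by ring
  have h3 : ‖(oseenWeightBC m ζ * (cdot ζ a * cdot ζ b)) • ζ‖ ≤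
      ‖oseenWeightBC m ζ‖ * ‖ζ‖ ^ 3 * ‖a‖ * ‖b‖ := by
    rw [norm_smul, norm_mul, norm_mul]
    calc ‖oseenWeightBC m ζ‖ * (‖cdot ζ a‖ * ‖cdot ζ b‖) * ‖ζ‖
        ≤ ‖oseenWeightBC m ζ‖ * ((‖ζ‖ * ‖a‖) * (‖ζ‖ * ‖b‖)) * ‖ζ‖ := by gcongr
      _ = _ := by ring
  calc _ ≤ ‖(-(cdot ζ a * ((2 : ℂ) * m ^ 2)⁻¹ * heatKernelC m ζ)) • b +
          oseenWeightAC m ζ • (cdot ζ a • b + cdot a b • ζ + cdot ζ b • a)‖ +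
        ‖(oseenWeightBC m ζ * (cdot ζ a * cdot ζ b)) • ζ‖ := norm_sub_le _ _
    _ ≤ (‖(-(cdot ζ a * ((2 : ℂ) * m ^ 2)⁻¹ * heatKernelC m ζ)) • b‖ +
          ‖oseenWeightAC m ζ • (cdot ζ a • b + cdot a b • ζ + cdot ζ b • a)‖) +
        ‖(oseenWeightBC m ζ * (cdot ζ a * cdot ζ b)) • ζ‖ := by gcongr; exact norm_add_le _ _
    _ ≤ _ := by nlinarith [h1, h2, h3]

/-- **Koch–Tataru's kernel bound (14) for the complexified kernel**: there is `C = C(ι) > 0`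
such that for every root time `m` in the sector `0 < Re m`, `|Im m| ≤ Re m/2`, every complex
shift `‖c‖ ≤ ‖m‖`, and all `z ∈ ℝ^ι`, `a, b ∈ ℂ^ι`,
`‖oseenKernelC m (cx z - c) a b‖ ≤ C ((25/6)(Re m)² + ‖z‖²)^{-(d+1)/2} ‖a‖ ‖b‖` — the real
parabolic majorant at the dilated time `τ' = (25/6)ρ²` (Lemarié-Rieusset 2016, proof of Thm. 9.12,
p. 262: `|∂ₗO_{j,k}(Z)| ≤ C_γ`, `|Z|⁴ |∂ₗO_{j,k}(Z)| ≤ C_γ` on `Ω_γ`; Koch–Tataru 2001, (14)).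
Proof: `norm_oseenKernelC_le` with the dominations of `𝒢, 𝒜, ℬ` by `G, A, B` at time `τ'` and the
tree's bounds `exists_heatKernel_le_rpow`, `exists_oseenWeightA_le`, `exists_oseenWeightB_le`.
[cite: LemarieRieusset2016, Thm. 9.12 (proof, p. 262)] -/
theorem exists_norm_oseenKernelC_shift_le :
    ∃ C : ℝ, 0 < C ∧ ∀ {m : ℂ}, 0 < m.re → |m.im| ≤ m.re / 2 → ∀ {c : (EuclideanSpace ℂ ι)}, ‖c‖ ≤ ‖m‖ →
      ∀ (z : (EuclideanSpace ℝ ι)) (a b : (EuclideanSpace ℂ ι)),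
        ‖oseenKernelC m (complexify z - c) a b‖ ≤
          C * (25 / 6 * m.re ^ 2 + ‖z‖ ^ 2) ^ (-(((Module.finrank ℝ (EuclideanSpace ℝ ι) : ℝ) + 1) / 2)) *
            ‖a‖ * ‖b‖ := by
  set d : ℝ := (Module.finrank ℝ (EuclideanSpace ℝ ι) : ℝ) with hd
  have hdι : (Fintype.card ι : ℝ) = d := by rw [hd, finrank_euclideanSpace]
  obtain ⟨C₁, hC₁, hG⟩ := exists_heatKernel_le_rpow (E := (EuclideanSpace ℝ ι)) (d / 2 + 1)
  obtain ⟨C₂, hC₂, hA⟩ := exists_oseenWeightA_le (E := (EuclideanSpace ℝ ι))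
  obtain ⟨C₃, hC₃, hB⟩ := exists_oseenWeightB_le (E := (EuclideanSpace ℝ ι))
  set L : ℝ := (25 / 6 : ℝ) with hL
  have hLpos : 0 < L := by norm_num
  set K₀ : ℝ := Real.exp 2 * L ^ (d / 2) with hK₀
  set K₁ : ℝ := Real.exp 2 * L ^ (d / 2 + 1) with hK₁
  set K₂ : ℝ := Real.exp 2 * L ^ (d / 2 + 2) with hK₂
  refine ⟨5 / 2 * (L / 2) * K₀ * C₁ + 3 * K₁ * C₂ * (5 / 2) + K₂ * C₃ * (5 / 2) ^ 3,
    by positivity, fun {m} hm hsec {c} hc z a b => ?_⟩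
  set ρ : ℝ := m.re with hρ
  set τ' : ℝ := L * ρ ^ 2 with hτ'
  have hτ'0 : 0 < τ' := by positivity
  set P : ℝ := τ' + ‖z‖ ^ 2 with hP
  have hP0 : 0 < P := by positivity
  set ζ : (EuclideanSpace ℂ ι) := complexify z - c with hζ
  -- ingredients
  have hζP : ‖ζ‖ ≤ 5 / 2 * P ^ (1 / 2 : ℝ) := norm_shift_le_rpow_half hm hsec hc z
  have h2m : ‖((2 : ℂ) * m ^ 2)⁻¹‖ ≤ (2 * ρ ^ 2)⁻¹ := by
    have := norm_inv_const_mul_pow_le hm (by norm_num : (0 : ℝ) < 2) 2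
    push_cast at this; exact this
  have hGc : ‖heatKernelC m ζ‖ ≤ K₀ * heatKernel τ' z := by
    have := norm_heatKernelC_shift_le hm hsec hc z; rwa [hdι] at this
  have hAc : ‖oseenWeightAC m ζ‖ ≤ K₁ * oseenWeightA τ' z := by
    have := norm_oseenWeightAC_shift_le hm hsec hc z; rwa [hdι] at this
  have hBc : ‖oseenWeightBC m ζ‖ ≤ K₂ * oseenWeightB τ' z := by
    have := norm_oseenWeightBC_shift_le hm hsec hc z; rwa [hdι] at this
  have hG' := hG hτ'0 z
  have hτe : τ' ^ (d / 2 + 1 - d / 2) = τ' := by ring_nf; exact Real.rpow_one τ'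
  rw [hτe] at hG'
  obtain ⟨-, hA0, hAle⟩ := hA hτ'0 z
  obtain ⟨-, hB0, hBle⟩ := hB hτ'0 z
  -- powers of `P`
  have hpow1 : P ^ (-(d / 2 + 1)) * P ^ (1 / 2 : ℝ) = P ^ (-((d + 1) / 2)) := by
    rw [← Real.rpow_add hP0]; ring_nf
  have hpow3 : P ^ (-(d / 2 + 2)) * (P ^ (1 / 2 : ℝ)) ^ 3 = P ^ (-((d + 1) / 2)) := by
    rw [← Real.rpow_natCast, ← Real.rpow_mul hP0.le, ← Real.rpow_add hP0]; ring_nf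
  have hρτ : (2 * ρ ^ 2)⁻¹ = L / 2 / τ' := by rw [hτ']; field_simp
  -- term 1
  have h1 : ‖ζ‖ * ‖((2 : ℂ) * m ^ 2)⁻¹‖ * ‖heatKernelC m ζ‖ ≤
      5 / 2 * (L / 2) * K₀ * C₁ * P ^ (-((d + 1) / 2)) := by
    calc ‖ζ‖ * ‖((2 : ℂ) * m ^ 2)⁻¹‖ * ‖heatKernelC m ζ‖
        ≤ (5 / 2 * P ^ (1 / 2 : ℝ)) * (2 * ρ ^ 2)⁻¹ * (K₀ * (C₁ * τ' * P ^ (-(d / 2 + 1)))) := by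
          gcongr
          exact hGc.trans (mul_le_mul_of_nonneg_left hG' (by positivity))
      _ = 5 / 2 * (L / 2) * K₀ * C₁ * (P ^ (-(d / 2 + 1)) * P ^ (1 / 2 : ℝ)) := by
          rw [hρτ]; field_simp
      _ = _ := by rw [hpow1]
  -- term 2
  have h2 : 3 * ‖oseenWeightAC m ζ‖ * ‖ζ‖ ≤ 3 * K₁ * C₂ * (5 / 2) * P ^ (-((d + 1) / 2)) := by
    calc 3 * ‖oseenWeightAC m ζ‖ * ‖ζ‖
        ≤ 3 * (K₁ * (C₂ * P ^ (-(d / 2 + 1)))) * (5 / 2 * P ^ (1 / 2 : ℝ)) := by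
          gcongr
          exact hAc.trans (mul_le_mul_of_nonneg_left hAle (by positivity))
      _ = 3 * K₁ * C₂ * (5 / 2) * (P ^ (-(d / 2 + 1)) * P ^ (1 / 2 : ℝ)) := by ring
      _ = _ := by rw [hpow1]
  -- term 3
  have h3 : ‖oseenWeightBC m ζ‖ * ‖ζ‖ ^ 3 ≤ K₂ * C₃ * (5 / 2) ^ 3 * P ^ (-((d + 1) / 2)) := by
    calc ‖oseenWeightBC m ζ‖ * ‖ζ‖ ^ 3
        ≤ (K₂ * (C₃ * P ^ (-(d / 2 + 2)))) * (5 / 2 * P ^ (1 / 2 : ℝ)) ^ 3 := by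
          gcongr
          exact hBc.trans (mul_le_mul_of_nonneg_left hBle (by positivity))
      _ = K₂ * C₃ * (5 / 2) ^ 3 * (P ^ (-(d / 2 + 2)) * (P ^ (1 / 2 : ℝ)) ^ 3) := by ring
      _ = _ := by rw [hpow3]
  calc ‖oseenKernelC m ζ a b‖
      ≤ (‖ζ‖ * ‖((2 : ℂ) * m ^ 2)⁻¹‖ * ‖heatKernelC m ζ‖ + 3 * ‖oseenWeightAC m ζ‖ * ‖ζ‖ +
          ‖oseenWeightBC m ζ‖ * ‖ζ‖ ^ 3) * ‖a‖ * ‖b‖ := norm_oseenKernelC_le m ζ a b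
    _ ≤ (5 / 2 * (L / 2) * K₀ * C₁ * P ^ (-((d + 1) / 2)) +
          3 * K₁ * C₂ * (5 / 2) * P ^ (-((d + 1) / 2)) +
          K₂ * C₃ * (5 / 2) ^ 3 * P ^ (-((d + 1) / 2))) * ‖a‖ * ‖b‖ := by gcongr
    _ = _ := by ring

end KernelBound

/-! ### `L¹` bounds of the shifted kernels -/

section Integrals

variable {m : ℂ}

/-- **`L¹` bound for the complexified Oseen kernel against bounded fields**: there is
`C = C(ι) > 0` such that for `m` in the sector, `‖c‖ ≤ ‖m‖`, fields `A, B : ℝ^ι → ℂ^ι` bounded by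
`M_A, M_B`, and every `x`,
`∫⁻ ‖oseenKernelC m (cx (x - y) - c)[A y, B y]‖ dy ≤ C M_A M_B / Re m`
(the parabolic majorant integrates to `τ'^{-1/2} ∫(1+‖w‖²)^{-(d+1)/2} dw`, `τ' = (25/6)ρ²`;
Lemarié-Rieusset 2016, p. 263, first display: "`≤ C_γ sup‖V‖_∞ sup‖W‖_∞ ∫∫ dt dα/(t² + |α|⁴)`").
[cite: LemarieRieusset2016, Thm. 9.12 (proof, p. 263)] -/
theorem exists_lintegral_oseenKernelC_shift_le :
    ∃ C : ℝ, 0 < C ∧ ∀ {m : ℂ}, 0 < m.re → |m.im| ≤ m.re / 2 → ∀ {c : (EuclideanSpace ℂ ι)}, ‖c‖ ≤ ‖m‖ →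
      ∀ {A B : (EuclideanSpace ℝ ι) → (EuclideanSpace ℂ ι)} {MA MB : ℝ}, 0 ≤ MA → 0 ≤ MB → (∀ y, ‖A y‖ ≤ MA) → (∀ y, ‖B y‖ ≤ MB) →
        ∀ x : (EuclideanSpace ℝ ι), ∫⁻ y, ‖oseenKernelC m (complexify (x - y) - c) (A y) (B y)‖ₑ ≤
          ENNReal.ofReal (C * MA * MB / m.re) := by
  set d : ℝ := (Module.finrank ℝ (EuclideanSpace ℝ ι) : ℝ) with hd
  obtain ⟨C, hC, hK⟩ := exists_norm_oseenKernelC_shift_le (ι := ι)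
  set M₀ : ℝ := ∫ w : (EuclideanSpace ℝ ι), (1 + ‖w‖ ^ 2) ^ (-((d + 1) / 2)) with hM₀
  have he : d < 2 * ((d + 1) / 2) := by linarith
  have hM₀0 : 0 < M₀ := integral_one_add_norm_sq_rpow_neg_pos he
  have hL : (0 : ℝ) < (25 / 6 : ℝ) ^ (-(1 / 2 : ℝ)) := Real.rpow_pos_of_pos (by norm_num) _
  refine ⟨C * M₀ * (25 / 6 : ℝ) ^ (-(1 / 2 : ℝ)), by positivity,
    fun {m} hm hsec {c} hc {A B MA MB} hMA hMB hAb hBb x => ?_⟩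
  set ρ : ℝ := m.re with hρ
  set τ' : ℝ := 25 / 6 * ρ ^ 2 with hτ'
  have hτ'0 : 0 < τ' := by positivity
  -- pointwise domination by the translated majorant
  set g : (EuclideanSpace ℝ ι) → ℝ≥0∞ := fun z => ENNReal.ofReal ((τ' + ‖z‖ ^ 2) ^ (-((d + 1) / 2))) with hg
  have hdom : ∀ y, ‖oseenKernelC m (complexify (x - y) - c) (A y) (B y)‖ₑ ≤
      ENNReal.ofReal (C * MA * MB) * g (x - y) := by
    intro y
    rw [hg, ← ENNReal.ofReal_mul (by positivity), ← ofReal_norm]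
    refine ENNReal.ofReal_le_ofReal ?_
    have hw0 : 0 ≤ C * (τ' + ‖x - y‖ ^ 2) ^ (-((d + 1) / 2)) :=
      mul_nonneg hC.le (Real.rpow_nonneg (by positivity) _)
    calc ‖oseenKernelC m (complexify (x - y) - c) (A y) (B y)‖
        ≤ C * (τ' + ‖x - y‖ ^ 2) ^ (-((d + 1) / 2)) * ‖A y‖ * ‖B y‖ := hK hm hsec hc (x - y) _ _
      _ ≤ C * (τ' + ‖x - y‖ ^ 2) ^ (-((d + 1) / 2)) * MA * MB :=
          mul_le_mul (mul_le_mul_of_nonneg_left (hAb y) hw0) (hBb y) (norm_nonneg _)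
            (mul_nonneg hw0 hMA)
      _ = C * MA * MB * (τ' + ‖x - y‖ ^ 2) ^ (-((d + 1) / 2)) := by ring
  have hscal : d / 2 - (d + 1) / 2 = -(1 / 2 : ℝ) := by ring
  have hτpow : τ' ^ (-(1 / 2 : ℝ)) = (25 / 6 : ℝ) ^ (-(1 / 2 : ℝ)) * ρ⁻¹ := by
    rw [hτ', Real.mul_rpow (by norm_num) (by positivity)]
    congr 1
    rw [← Real.rpow_natCast ρ 2, ← Real.rpow_mul hm.le, ← Real.rpow_neg_one]
    norm_num
  calc ∫⁻ y, ‖oseenKernelC m (complexify (x - y) - c) (A y) (B y)‖ₑ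
      ≤ ∫⁻ y, ENNReal.ofReal (C * MA * MB) * g (x - y) := lintegral_mono hdom
    _ = ENNReal.ofReal (C * MA * MB) * ∫⁻ y, g y := by
        rw [lintegral_const_mul' _ _ ENNReal.ofReal_ne_top, lintegral_sub_left_eq_self g x]
    _ = ENNReal.ofReal (C * MA * MB) * ENNReal.ofReal (τ' ^ (-(1 / 2 : ℝ)) * M₀) := by
        rw [hg, lintegral_add_norm_sq_rpow_neg he hτ'0, hscal]
    _ = ENNReal.ofReal (C * M₀ * (25 / 6 : ℝ) ^ (-(1 / 2 : ℝ)) * MA * MB / ρ) := by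
        rw [← ENNReal.ofReal_mul (by positivity), hτpow]
        congr 1; field_simp

/-- **`L¹` bound for the complexified Gaussian against a bounded field**: for `m` in the sector,
`‖c‖ ≤ ‖m‖`, `‖F y‖ ≤ M_F`, and every `x`,
`∫⁻ |heatKernelC m (cx (x - y) - c)| ‖F y‖ dy ≤ e² (25/6)^{d/2} M_F` (domination by the real
Gaussian of mass one at the dilated time; Lemarié-Rieusset 2016, p. 262:
"`‖V₀‖_{L^∞(t₀+Ω_γ)} ≤ C_γ ‖u(t₀,.)‖_∞`"). [cite: LemarieRieusset2016, Thm. 9.12 (proof, p. 262)] -/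
theorem lintegral_heatKernelC_shift_le (hm : 0 < m.re) (hsec : |m.im| ≤ m.re / 2) {c : (EuclideanSpace ℂ ι)}
    (hc : ‖c‖ ≤ ‖m‖) {F : (EuclideanSpace ℝ ι) → (EuclideanSpace ℂ ι)} {MF : ℝ} (hMF : 0 ≤ MF) (hF : ∀ y, ‖F y‖ ≤ MF) (x : (EuclideanSpace ℝ ι)) :
    ∫⁻ y, ‖heatKernelC m (complexify (x - y) - c)‖ₑ * ‖F y‖ₑ ≤
      ENNReal.ofReal (Real.exp 2 * (25 / 6 : ℝ) ^ ((Fintype.card ι : ℝ) / 2) * MF) := by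
  set ρ : ℝ := m.re with hρ
  set τ' : ℝ := 25 / 6 * ρ ^ 2 with hτ'
  have hτ'0 : 0 < τ' := by positivity
  set K₀ : ℝ := Real.exp 2 * (25 / 6 : ℝ) ^ ((Fintype.card ι : ℝ) / 2) with hK₀
  have hK₀0 : 0 ≤ K₀ := by positivity
  set g : (EuclideanSpace ℝ ι) → ℝ≥0∞ := fun z => ENNReal.ofReal (heatKernel τ' z) with hg
  have hdom : ∀ y, ‖heatKernelC m (complexify (x - y) - c)‖ₑ * ‖F y‖ₑ ≤
      ENNReal.ofReal (K₀ * MF) * g (x - y) := by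
    intro y
    rw [hg, ← ENNReal.ofReal_mul (by positivity), ← ofReal_norm, ← ofReal_norm,
      ← ENNReal.ofReal_mul (norm_nonneg _)]
    refine ENNReal.ofReal_le_ofReal ?_
    calc ‖heatKernelC m (complexify (x - y) - c)‖ * ‖F y‖
        ≤ (K₀ * heatKernel τ' (x - y)) * MF :=
          mul_le_mul (norm_heatKernelC_shift_le hm hsec hc (x - y)) (hF y) (norm_nonneg _)
            (mul_nonneg hK₀0 (UnboundedOperators.heatKernel_pos hτ'0 _).le)
      _ = K₀ * MF * heatKernel τ' (x - y) := by ring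
  have hmass : ∫⁻ y, g y = 1 := by
    rw [hg, ← ofReal_integral_eq_lintegral_ofReal (UnboundedOperators.integrable_heatKernel_holds hτ'0)
      (Eventually.of_forall fun z => (UnboundedOperators.heatKernel_pos hτ'0 z).le),
      UnboundedOperators.integral_heatKernel_eq_one_holds hτ'0, ENNReal.ofReal_one]
  calc ∫⁻ y, ‖heatKernelC m (complexify (x - y) - c)‖ₑ * ‖F y‖ₑ
      ≤ ∫⁻ y, ENNReal.ofReal (K₀ * MF) * g (x - y) := lintegral_mono hdom
    _ = ENNReal.ofReal (K₀ * MF) * ∫⁻ y, g y := by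
        rw [lintegral_const_mul' _ _ ENNReal.ofReal_ne_top, lintegral_sub_left_eq_self g x]
    _ = ENNReal.ofReal (K₀ * MF) := by rw [hmass, mul_one]

end Integrals

/-! ### Continuity of the kernels away from `m = 0` -/

section Continuity

/-- The complexified Gaussian is jointly continuous in `(m, ζ)` on `{m ≠ 0}` (it is holomorphic
there). [folklore] -/
theorem continuousOn_heatKernelC :
    ContinuousOn (fun q : ℂ × (EuclideanSpace ℂ ι) => heatKernelC q.1 q.2) {q | q.1 ≠ 0} := by
  intro q hq
  have h : DifferentiableAt ℂ (fun r : ℂ × (EuclideanSpace ℂ ι) => heatKernelC r.1 r.2) q :=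
    differentiableAt_fst.heatKernelC differentiableAt_snd hq
  exact h.continuousAt.continuousWithinAt

/-- The complexified Oseen kernel is jointly continuous in `(m, ζ, a, b)` on `{m ≠ 0}` (it is
holomorphic there). [folklore] -/
theorem continuousOn_oseenKernelC :
    ContinuousOn (fun q : ℂ × (EuclideanSpace ℂ ι) × (EuclideanSpace ℂ ι) × (EuclideanSpace ℂ ι) => oseenKernelC q.1 q.2.1 q.2.2.1 q.2.2.2)
      {q | q.1 ≠ 0} := by
  intro q hq
  have h : DifferentiableAt ℂ
      (fun r : ℂ × (EuclideanSpace ℂ ι) × (EuclideanSpace ℂ ι) × (EuclideanSpace ℂ ι) => oseenKernelC r.1 r.2.1 r.2.2.1 r.2.2.2) q :=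
    differentiableAt_fst.oseenKernelC differentiableAt_snd.fst differentiableAt_snd.snd.fst
      differentiableAt_snd.snd.snd hq
  exact h.continuousAt.continuousWithinAt

end Continuity

end Literature.Analysis.FluidPDE

end
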